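import Mathlib
import Literature.Analysis.Complex.ConeTubeIdentity
import HarnessLib

/-!
# Gluing local strip continuations of a periodic function into an entire function

Topic `Literature/Analysis/Complex`. PROVED, no definitions.

`exists_entire_of_periodic_local_continuations`: let `κ : ℝ → ℂ` be `T`-periodic and suppose every
real point `θ₀` has a neighbourhood `|θ - θ₀| < ε` on which `κ` is the restriction of a function
`F_{θ₀}` holomorphic on the whole vertical strip `|Re z - θ₀| < ε` and bounded there by
`C_{θ₀} e^{τ |Im z|}`. Then `κ` is the restriction of an ENTIRE function `G` with
`‖G z‖ ≤ C e^{τ |Im z|}` for one constant `C`: neighbouring continuations agree on the common strip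
(identity theorem from the real points, `eqOn_of_isPreconnected_of_eq_ofReal`), so
`G z := F_{Re z} z` is well defined and entire; it is `T`-periodic by the identity theorem, and one
period is covered by finitely many strips (compactness), which makes the constant global. This is
the bookkeeping step "finitely many usable frames cover a period" of analytic-continuation arguments
for orbit functions `θ ↦ S(R_θ x)` (Boas, *Entire Functions* (1954), Ch. 1; exponential type).

`exists_strip_continuation_of_rectangles`: the local version in the imaginary direction — continuations
`F_R` to the rectangles `|Re z - θ₀| < ε, |Im z| < R` with common real values and bounds `K e^{cR}`
glue to ONE continuation to the strip with the bound `K e^{c} e^{c |Im z|}`.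

## References
* R. P. Boas, *Entire Functions* (1954), Ch. 1–2. [folklore]
-/

noncomputable section

open Complex Set Filter Topology

namespace Literature.Analysis.Complex

/-- The vertical strip `|Re z - θ| < ε` is open. [folklore] -/
theorem isOpen_abs_re_sub_lt (θ ε : ℝ) : IsOpen {z : ℂ | |z.re - θ| < ε} :=
  isOpen_lt (continuous_abs.comp (continuous_re.sub continuous_const)) continuous_const

/-- The vertical strip `|Re z - θ| < ε` is convex. [folklore] -/
theorem convex_abs_re_sub_lt (θ ε : ℝ) : Convex ℝ {z : ℂ | |z.re - θ| < ε} := by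
  have : {z : ℂ | |z.re - θ| < ε} = {z : ℂ | z.re < θ + ε} ∩ {z : ℂ | θ - ε < z.re} := by
    ext z; simp only [mem_setOf_eq, mem_inter_iff, abs_lt]; constructor <;> intro h <;>
      constructor <;> linarith [h.1, h.2]
  rw [this]
  exact (convex_halfSpace_re_lt _).inter (convex_halfSpace_re_gt _)

/-- **Local strip continuations agree on common strips** (identity theorem from the real points). [folklore] -/
theorem eq_of_local_continuations {κ : ℝ → ℂ} {θ₁ θ₂ ε₁ ε₂ : ℝ} {F₁ F₂ : ℂ → ℂ}
    (h₁ : DifferentiableOn ℂ F₁ {z : ℂ | |z.re - θ₁| < ε₁}) (hκ₁ : ∀ θ : ℝ, |θ - θ₁| < ε₁ → F₁ θ = κ θ)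
    (h₂ : DifferentiableOn ℂ F₂ {z : ℂ | |z.re - θ₂| < ε₂}) (hκ₂ : ∀ θ : ℝ, |θ - θ₂| < ε₂ → F₂ θ = κ θ)
    {z : ℂ} (hz₁ : |z.re - θ₁| < ε₁) (hz₂ : |z.re - θ₂| < ε₂) : F₁ z = F₂ z := by
  set U : Set ℂ := {w : ℂ | |w.re - θ₁| < ε₁} ∩ {w : ℂ | |w.re - θ₂| < ε₂} with hU
  have hUo : IsOpen U := (isOpen_abs_re_sub_lt θ₁ ε₁).inter (isOpen_abs_re_sub_lt θ₂ ε₂)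
  have hUc : IsPreconnected U := ((convex_abs_re_sub_lt θ₁ ε₁).inter (convex_abs_re_sub_lt θ₂ ε₂)).isPreconnected
  have hx : ((z.re : ℝ) : ℂ) ∈ U := ⟨by simpa using hz₁, by simpa using hz₂⟩
  refine eqOn_of_isPreconnected_of_eq_ofReal hUo hUc hx (h₁.mono inter_subset_left)
    (h₂.mono inter_subset_right) (fun t ht => ?_) ⟨hz₁, hz₂⟩
  have ht₁ : |t - θ₁| < ε₁ := by simpa using ht.1
  have ht₂ : |t - θ₂| < ε₂ := by simpa using ht.2
  rw [hκ₁ t ht₁, hκ₂ t ht₂]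

/-- **Gluing local strip continuations of a periodic function.** If `κ : ℝ → ℂ` is `T`-periodic
(`T > 0`) and every real `θ₀` admits `ε > 0`, `C` and `F` holomorphic on the strip `|Re z - θ₀| < ε`
with `F = κ` on its real points and `‖F z‖ ≤ C e^{τ |Im z|}` there, then there is an entire `G`
with `G = κ` on `ℝ` and `‖G z‖ ≤ C' e^{τ |Im z|}` for a single constant `C'`. [folklore] -/
theorem exists_entire_of_periodic_local_continuations {κ : ℝ → ℂ} {T τ : ℝ} (hT : 0 < T)
    (hper : ∀ θ : ℝ, κ (θ + T) = κ θ)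
    (hloc : ∀ θ₀ : ℝ, ∃ ε : ℝ, 0 < ε ∧ ∃ C : ℝ, ∃ F : ℂ → ℂ,
      DifferentiableOn ℂ F {z : ℂ | |z.re - θ₀| < ε} ∧
      (∀ θ : ℝ, |θ - θ₀| < ε → F θ = κ θ) ∧
      ∀ z : ℂ, |z.re - θ₀| < ε → ‖F z‖ ≤ C * Real.exp (τ * |z.im|)) :
    ∃ G : ℂ → ℂ, Differentiable ℂ G ∧ (∀ θ : ℝ, G θ = κ θ) ∧
      ∃ C : ℝ, ∀ z : ℂ, ‖G z‖ ≤ C * Real.exp (τ * |z.im|) := by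
  choose ε hε C F hFd hFκ hFb using hloc
  -- neighbouring continuations agree
  have hagree : ∀ (θ₁ θ₂ : ℝ) (z : ℂ), |z.re - θ₁| < ε θ₁ → |z.re - θ₂| < ε θ₂ → F θ₁ z = F θ₂ z :=
    fun θ₁ θ₂ z h1 h2 => eq_of_local_continuations (hFd θ₁) (hFκ θ₁) (hFd θ₂) (hFκ θ₂) h1 h2
  -- the glued function
  set G : ℂ → ℂ := fun z => F z.re z with hG
  have hGF : ∀ (θ : ℝ) (z : ℂ), |z.re - θ| < ε θ → G z = F θ z := fun θ z hz =>
    hagree z.re θ z (by simpa using hε z.re) hz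
  have hGκ : ∀ θ : ℝ, G θ = κ θ := fun θ => by
    show F ((θ : ℂ).re) θ = κ θ
    rw [ofReal_re]
    exact hFκ θ θ (by simpa using hε θ)
  have hGd : Differentiable ℂ G := by
    intro z₁
    have hmem : {z : ℂ | |z.re - z₁.re| < ε z₁.re} ∈ 𝓝 z₁ :=
      (isOpen_abs_re_sub_lt _ _).mem_nhds (by simpa using hε z₁.re)
    have heq : G =ᶠ[𝓝 z₁] F z₁.re := Filter.eventually_of_mem hmem fun z hz => hGF z₁.re z hz
    refine (heq.differentiableAt_iff).2 ?_
    exact (hFd z₁.re).differentiableAt hmem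
  -- periodicity of `G`
  have hGper : Function.Periodic G (T : ℂ) := by
    intro z
    have h := eqOn_of_isPreconnected_of_eq_ofReal (f := fun w => G (w + T)) (g := G) isOpen_univ
      isPreconnected_univ (x₀ := 0) (mem_univ _)
      ((hGd.comp (differentiable_id.add_const _)).differentiableOn) hGd.differentiableOn
      (fun t _ => by
        have : ((t : ℂ) + T) = ((t + T : ℝ) : ℂ) := by push_cast; ring
        simp only [this, hGκ, hper])
    exact h (mem_univ z)
  refine ⟨G, hGd, hGκ, ?_⟩
  -- the global bound from finitely many strips covering one period
  obtain ⟨t, ht⟩ := (isCompact_Icc (a := (0 : ℝ)) (b := T)).elim_finite_subcover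
    (fun θ : ℝ => {x : ℝ | |x - θ| < ε θ})
    (fun θ => isOpen_lt (continuous_abs.comp (continuous_id.sub continuous_const)) continuous_const)
    (fun x _ => mem_iUnion.2 ⟨x, by simpa using hε x⟩)
  refine ⟨∑ θ ∈ t, |C θ|, fun z => ?_⟩
  -- reduce to the fundamental period
  set n : ℤ := ⌊z.re / T⌋ with hn
  set z' : ℂ := z - (n : ℂ) * T with hz'
  have hzz' : G z = G z' := by
    rw [hz']
    exact ((hGper.int_mul n).sub_eq z).symm
  have hre : z'.re = z.re - n * T := by simp [hz']
  have him : z'.im = z.im := by simp [hz']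
  have hmem : z'.re ∈ Icc (0 : ℝ) T := by
    rw [hre]
    have h1 : (n : ℝ) ≤ z.re / T := Int.floor_le _
    have h2 : z.re / T < n + 1 := Int.lt_floor_add_one _
    constructor
    · have := (le_div_iff₀ hT).1 h1; linarith
    · have := (div_lt_iff₀ hT).1 h2; linarith
  obtain ⟨θ, hθt, hθ⟩ : ∃ θ ∈ t, |z'.re - θ| < ε θ := by
    have := ht hmem
    simp only [mem_iUnion, mem_setOf_eq, exists_prop] at this
    exact this
  have hCle : |C θ| ≤ ∑ θ ∈ t, |C θ| :=
    Finset.single_le_sum (f := fun θ => |C θ|) (fun _ _ => abs_nonneg _) hθt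
  calc ‖G z‖ = ‖F θ z'‖ := by rw [hzz', hGF θ z' hθ]
    _ ≤ C θ * Real.exp (τ * |z'.im|) := hFb θ z' hθ
    _ ≤ |C θ| * Real.exp (τ * |z'.im|) := by gcongr; exact le_abs_self _
    _ = |C θ| * Real.exp (τ * |z.im|) := by rw [him]
    _ ≤ (∑ θ ∈ t, |C θ|) * Real.exp (τ * |z.im|) := by gcongr

/-- The open rectangle `|Re z - θ₀| < ε, |Im z| < R` is open. [folklore] -/
theorem isOpen_rect (θ₀ ε R : ℝ) : IsOpen {z : ℂ | |z.re - θ₀| < ε ∧ |z.im| < R} :=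
  (isOpen_abs_re_sub_lt θ₀ ε).inter (isOpen_lt (continuous_abs.comp continuous_im) continuous_const)

/-- The open rectangle `|Re z - θ₀| < ε, |Im z| < R` is convex. [folklore] -/
theorem convex_rect (θ₀ ε R : ℝ) : Convex ℝ {z : ℂ | |z.re - θ₀| < ε ∧ |z.im| < R} := by
  have : {z : ℂ | |z.im| < R} = {z : ℂ | z.im < R} ∩ {z : ℂ | -R < z.im} := by
    ext z; simp only [mem_setOf_eq, mem_inter_iff, abs_lt]; tauto
  have h2 : Convex ℝ {z : ℂ | |z.im| < R} := by
    rw [this]; exact (convex_halfSpace_im_lt _).inter (convex_halfSpace_im_gt _)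
  exact (convex_abs_re_sub_lt θ₀ ε).inter h2

/-- **Rectangle continuations with common real values agree** on the common rectangle. [folklore] -/
theorem eq_of_rect_continuations {κ : ℝ → ℂ} {θ₀ ε R R' : ℝ} (hε : 0 < ε) (hR : 0 < R) (hR' : 0 < R')
    {F F' : ℂ → ℂ} (hF : DifferentiableOn ℂ F {z : ℂ | |z.re - θ₀| < ε ∧ |z.im| < R})
    (hκ : ∀ θ : ℝ, |θ - θ₀| < ε → F θ = κ θ)
    (hF' : DifferentiableOn ℂ F' {z : ℂ | |z.re - θ₀| < ε ∧ |z.im| < R'})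
    (hκ' : ∀ θ : ℝ, |θ - θ₀| < ε → F' θ = κ θ)
    {z : ℂ} (hz : |z.re - θ₀| < ε) (hzR : |z.im| < R) (hzR' : |z.im| < R') : F z = F' z := by
  set U : Set ℂ := {w : ℂ | |w.re - θ₀| < ε ∧ |w.im| < min R R'} with hU
  have hx : ((θ₀ : ℝ) : ℂ) ∈ U := ⟨by simpa using hε, by simpa using lt_min hR hR'⟩
  refine eqOn_of_isPreconnected_of_eq_ofReal (isOpen_rect θ₀ ε (min R R'))
    (convex_rect θ₀ ε (min R R')).isPreconnected hx
    (hF.mono fun w hw => ⟨hw.1, hw.2.trans_le (min_le_left _ _)⟩)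
    (hF'.mono fun w hw => ⟨hw.1, hw.2.trans_le (min_le_right _ _)⟩) (fun t ht => ?_)
    ⟨hz, lt_min hzR hzR'⟩
  have ht' : |t - θ₀| < ε := by simpa using ht.1
  rw [hκ t ht', hκ' t ht']

/-- **Gluing rectangle continuations into a strip continuation.** If for every `R > 0` the real
function `κ` continues from `|θ - θ₀| < ε` to a holomorphic function on the rectangle
`|Re z - θ₀| < ε, |Im z| < R` bounded by `K e^{cR}` (`c ≥ 0`), then it continues to the whole strip
`|Re z - θ₀| < ε` with the bound `K e^{c} e^{c |Im z|}`. [folklore] -/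
theorem exists_strip_continuation_of_rectangles {κ : ℝ → ℂ} {θ₀ ε K c : ℝ}
    (h : ∀ R : ℝ, 0 < R → ∃ F : ℂ → ℂ,
      DifferentiableOn ℂ F {z : ℂ | |z.re - θ₀| < ε ∧ |z.im| < R} ∧
      (∀ θ : ℝ, |θ - θ₀| < ε → F θ = κ θ) ∧
      ∀ z : ℂ, |z.re - θ₀| < ε → |z.im| < R → ‖F z‖ ≤ K * Real.exp (c * R)) :
    ∃ F : ℂ → ℂ, DifferentiableOn ℂ F {z : ℂ | |z.re - θ₀| < ε} ∧
      (∀ θ : ℝ, |θ - θ₀| < ε → F θ = κ θ) ∧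
      ∀ z : ℂ, |z.re - θ₀| < ε → ‖F z‖ ≤ (K * Real.exp c) * Real.exp (c * |z.im|) := by
  by_cases hε : 0 < ε
  swap
  · have hneg : ∀ r : ℝ, ¬ |r| < ε := fun r hr => hε ((abs_nonneg r).trans_lt hr)
    refine ⟨fun _ => 0, ?_, fun θ hθ => (hneg _ hθ).elim, fun z hz => (hneg _ hz).elim⟩
    intro z hz; exact (hneg _ hz).elim
  choose! F hFd hFκ hFb using h
  have hagree : ∀ (R R' : ℝ), 0 < R → 0 < R' → ∀ z : ℂ, |z.re - θ₀| < ε → |z.im| < R → |z.im| < R' →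
      F R z = F R' z := fun R R' hR hR' z hz h1 h2 =>
    eq_of_rect_continuations hε hR hR' (hFd R hR) (hFκ R hR) (hFd R' hR') (hFκ R' hR') hz h1 h2
  refine ⟨fun z => F (|z.im| + 1) z, ?_, fun θ hθ => ?_, fun z hz => ?_⟩
  · intro z₁ hz₁
    have hR₁ : (0 : ℝ) < |z₁.im| + 2 := by positivity
    have hmem : {z : ℂ | |z.re - θ₀| < ε ∧ |z.im| < |z₁.im| + 2} ∈ 𝓝 z₁ :=
      (isOpen_rect θ₀ ε _).mem_nhds ⟨hz₁, by linarith [abs_nonneg z₁.im]⟩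
    have heq : (fun z => F (|z.im| + 1) z) =ᶠ[𝓝 z₁] F (|z₁.im| + 2) :=
      Filter.eventually_of_mem hmem fun z hz =>
        hagree _ _ (by positivity) hR₁ z hz.1 (by linarith) hz.2
    refine ((heq.differentiableAt_iff).2 ?_).differentiableWithinAt
    exact (hFd _ hR₁).differentiableAt hmem
  · show F (|((θ : ℂ)).im| + 1) θ = κ θ
    have : |((θ : ℂ)).im| + 1 = 1 := by simp
    rw [this]
    exact hFκ 1 one_pos θ hθ
  · have hR : (0 : ℝ) < |z.im| + 1 := by positivity
    calc ‖F (|z.im| + 1) z‖ ≤ K * Real.exp (c * (|z.im| + 1)) := hFb _ hR z hz (by linarith)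
      _ = (K * Real.exp c) * Real.exp (c * |z.im|) := by
          rw [mul_add, mul_one, Real.exp_add]; ring

end Literature.Analysis.Complex
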